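import Summits.NavierStokesRegularity.FluidComputer.BlockOpenGate

/-!
# Fourier-block instance — §12 OPEN WINDOWS ARE LIVE: per-orbit `H¹⁰` control suffices, and every
# energy-passive open circuit has it

HONEST FRAMING. Low prior, high value-of-information experiment on Tao's machine paradigm; NOT a
claim that NS blows up. Nothing in this file is evidence about Navier–Stokes: it closes the one gap
the open-window re-typing (`BlockOpenWindow` / `BlockOpenGate`) left in the lane's DESIGN-LEVEL
theorems.

THE GAP. `BlockOpenWindow` removed the inessential upper readout window `aHi` and inhabited the
CIRCUIT+CLOCK half conservatively (`openRegCircuitClock`), but recorded an honest price: the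
architecture's liveness hypothesis `ShadowedCircuit.H10Control` (ONE `H¹⁰` bound `M(n)` for every
state read anywhere in the shadowing tube `{Φ σ p : p ∈ Ain, σ ≤ τc}`) is FALSE as typed for the
open design, whose tube is unbounded (`recon n (a, 0)`, `a → ∞`, has unbounded `H¹⁰` norm and zero
junk). So `live_of_blockDynamics` and the cascade theorem did not transfer.

THE OBSERVATION (architecture level, §1). The liveness proof `ShadowedCircuit.live` follows ONE
circuit orbit: the maximal trajectory from a loaded state `v` is compared, through `shadow`, with
`Φ σ (read n v)` only. Hence the PER-ORBIT control
`H10ControlAt A : ∀ n, ∀ p ∈ Ain, ∃ M, ∀ v, (read n v is δsh-close to the orbit of p) → (running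
junk) → ‖v‖_{H¹⁰} ≤ M`
already gives `Live` (`live_of_h10ControlAt`, the same proof with `M` chosen after `p = read n v`);
`H10Control → H10ControlAt` trivially. This is a refinement of the architecture's bookkeeping, not
a new claim about the PDE.

THE DESIGN-LEVEL FACTS (§2–§3). For the Fourier-block design with open windows:
* `OpenCircuitClock.h10ControlAt` — `H10ControlAt` HOLDS (`s ≥ 10`, `μ > 0`) as soon as every
  single orbit `σ ↦ Φ σ p` (`p ∈ AinO`, `σ ≤ τc`) is bounded — by the tube-free analytic lemma
  `h10Bound_of_read_le` of `BlockControl`;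
* `orbitBound_of_passiveO` — every `ε`-PASSIVE open circuit (two-block energy `W = a² + η b²`
  non-increasing up to `ε` along orbits from `AinO`) has bounded orbits:
  `‖Φ σ p‖ ≤ √(W(p) + ε) (1 + 1/√η)`;
* hence `live_of_openIdeaBound`: for a passive open circuit the residue `OpenIdeaBound` alone makes
  the assembled pump cascade LIVE, and the CASCADE THEOREM transfers
  (`energy_reaches_all_scales_of_openIdeaBound`); in particular for the explicit conservative
  quarter turn on `Params.reg`, `η ∈ [1/2, 9/10]` (`live_of_openRegIdeaBound`,
  `energy_reaches_all_scales_of_openRegIdeaBound`).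

NET EFFECT ON THE LANE'S VERDICT. The open-window correction loses NOTHING of gen 31: blow-up,
stable blow-up, liveness and the cascade theorem all hold for the open conservative design given
the residue `OpenIdeaBound` — which this lane presumes FALSE for the two-wavelet design and does
not claim. No statement about the Navier–Stokes PDE is proved here.
-/

noncomputable section

open MeasureTheory Set Filter Topology Metric
open scoped ENNReal NNReal SchwartzMap

namespace Summit.NavierStokesRegularity.FluidComputer

open Literature.Analysis.FluidPDE Literature.Analysis.FluidPDE.Tao2016
open Literature.Analysis.FluidPDE.FluidComputer
open Literature.Analysis.FunctionSpaces (eFourierSobolevNorm)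
open Summit.NavierStokesRegularity.NavierStokesRegularity.Theorems.FluidComputer

/-! ## §1. Architecture refinement: per-orbit `H¹⁰` control suffices for liveness -/

section Arch

variable {S : CascadeSpecs} {O : Type*} [PseudoMetricSpace O] {s : ℝ} (A : ShadowedCircuit S O s)

/-- **Per-orbit `H¹⁰` control of the shadowing tube**: for every generation `n` and every gate
entry `p ∈ Ain` separately, one bound `M(n, p)` on the `H¹⁰` norm of the `H¹⁰_df` states whose
readout is `δsh`-close to the orbit `σ ↦ Φ σ p` (`σ ≤ τc`) and whose junk is below the running
threshold. Weaker than `ShadowedCircuit.H10Control` (one `M(n)` for the whole tube), and what the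
liveness argument actually consumes. [folklore] -/
def H10ControlAt : Prop :=
  ∀ n : ℕ, ∀ p ∈ A.Ain, ∃ M : ℝ, ∀ v : L2C, MemH10df v →
    (∃ σ : ℝ, 0 ≤ σ ∧ σ ≤ A.τc ∧ dist (A.read n v) (A.Φ σ p) ≤ A.δsh) →
      A.junk n v ≤ ENNReal.ofReal (A.jrun * Real.sqrt (S.Emin n)) →
        eFourierSobolevNorm 10 v ≤ ENNReal.ofReal M

/-- Uniform control implies per-orbit control. [folklore] -/
theorem h10ControlAt_of_h10Control (hctrl : A.H10Control) : H10ControlAt A := by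
  intro n p hp
  obtain ⟨M, hM⟩ := hctrl n
  exact ⟨M, fun v h10 ⟨σ, hσ0, hστ, hd⟩ hj => hM v h10 ⟨p, hp, σ, hσ0, hστ, hd⟩ hj⟩

/-- **Liveness from per-orbit control** (the proof of `ShadowedCircuit.live`, choosing the bound
after the gate entry `p = read n v`): a loaded `H¹⁰_df` state whose every trajectory dies within
the tick has a maximal trajectory with unbounded `H¹⁰` norm on `[0, S_m)`, `S_m ≤ unit n · τc`;
unguarded shadowing keeps its readout `δsh`-close to the orbit of `read n v` and its junk running
there, so `H10ControlAt` bounds the norm — contradiction. [folklore] -/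
theorem live_of_h10ControlAt (hth : H10MildTheory) (hctrl : H10ControlAt A) :
    A.toPumpCascade.Live := by
  intro n v hv h10
  by_contra hne
  push Not at hne
  have hle : ∀ (S' : ℝ) (u : ℝ → L2C), IsMildSolutionFor eulerForm v (Ico 0 S') u →
      S' ≤ A.unit n * A.τc := by
    intro S' u hu
    by_contra h
    exact hne S' (lt_of_not_ge h) u hu
  have hvIn : v ∈ A.In n := hv
  obtain ⟨M, hM⟩ := hctrl n (A.read n v) hvIn.1
  obtain ⟨Sm, hSm, hSmT, U, hU, -, hunb⟩ := exists_maximal_unbounded_of_lifespan_le hth h10 hle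
  obtain ⟨t', ht', hlt⟩ := hunb M
  have h0 : U 0 = v := initial_eq hU ⟨le_rfl, hSm⟩ h10
  have hv' : U 0 ∈ A.In n := by rw [h0]; exact hv
  have hne0 : A.unit n ≠ 0 := (A.unit_pos n).ne'
  set σ : ℝ := t' / A.unit n with hσdef
  have hσ0 : 0 ≤ σ := div_nonneg ht'.1 (A.unit_pos n).le
  have hσeq : A.unit n * σ = t' := by rw [mul_comm]; exact div_mul_cancel₀ t' hne0
  have hστ : σ ≤ A.τc := by
    have h1 : A.unit n * σ ≤ A.unit n * A.τc := by rw [hσeq]; exact ht'.2.le.trans hSmT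
    exact le_of_mul_le_mul_left h1 (A.unit_pos n)
  have hlt' : 0 + A.unit n * σ < Sm := by rw [zero_add, hσeq]; exact ht'.2
  have hsh := A.shadow n v Sm U hU 0 le_rfl hv'.1 hv'.2 σ hσ0 hστ hlt'
  have hlk := A.leak n v Sm U hU 0 le_rfl hv'.1 hv'.2 σ hσ0 hστ hlt'
  rw [zero_add, hσeq, h0] at hsh
  rw [zero_add, hσeq] at hlk
  have hbd := hM (U t') (hU.1 t' ht') ⟨σ, hσ0, hστ, hsh⟩ hlk
  exact absurd hlt (not_lt.2 hbd)

/-- **The cascade theorem from per-orbit control** (`α > 0`, `η > 1/4`): along the seed's maximal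
`H¹⁰_df`-mild trajectory the spec's energy `E_n` is present at frequency `≥ λ_n` at a clocked
instant `t_n ≤ ∑_{k<n} Tmax k < S_m ≤ T_*` for EVERY `n`, and the `H¹⁰` norm is unbounded on
`[0, S_m)`. [folklore] -/
theorem energy_reaches_all_scales_of_h10ControlAt (hα : 0 < S.alpha) (hη : 1 / 4 < S.eta)
    (hctrl : H10ControlAt A) :
    ∃ Sm : ℝ, 0 < Sm ∧ Sm ≤ S.Tstar ∧ ∃ U : ℝ → L2C,
      IsMildSolutionFor eulerForm (schwartzL2 A.u₀) (Ico 0 Sm) U ∧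
      (∀ C : ℝ, ∃ s ∈ Ico 0 Sm, ENNReal.ofReal C < eFourierSobolevNorm 10 (U s)) ∧
      ∃ t : ℕ → ℝ, t 0 = 0 ∧ Monotone t ∧
        ∀ n, t n < Sm ∧ t n ≤ ∑ k ∈ Finset.range n, S.Tmax k ∧
          ENNReal.ofReal (S.Emin n) ≤ highFreqEnergy (S.lam n) (U (t n)) :=
  energy_reaches_all_scales A.toPumpCascade hα hη (live_of_h10ControlAt A h10MildTheory_holds hctrl)

end Arch

namespace BlockDesign

/-! ## §2. The open block design has per-orbit control whenever single orbits are bounded -/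

section Control

variable {𝒟 : CascadeWaveletData 1 1} {S : CascadeSpecs} {P : Params S}

/-- **Per-orbit `H¹⁰` control is a theorem for the open Fourier-block design** (`s ≥ 10`, `μ > 0`)
as soon as every single circuit orbit from `AinO` is bounded in the observable plane: the readout
of a state `δsh`-close to the orbit of `p` is bounded by that orbit's bound plus `δsh`, and
`h10Bound_of_read_le` does the rest. [folklore] -/
theorem OpenCircuitClock.h10ControlAt (C : OpenCircuitClock P) (H : OpenIdeaBound 𝒟 P C)
    (hs : 10 ≤ P.s) (hμ : 0 < P.μ)
    (hT : ∀ p ∈ AinO P, ∃ R : ℝ, ∀ σ : ℝ, 0 ≤ σ → σ ≤ C.τc → ‖C.Φ σ p‖ ≤ R) :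
    H10ControlAt (C.toShadowedCircuit H) := by
  intro n p hp
  change p ∈ AinO P at hp
  obtain ⟨R, hR⟩ := hT p hp
  obtain ⟨M, hM⟩ := h10Bound_of_read_le (𝒟 := 𝒟) (P := P) hs hμ n (R' := max (R + C.δsh) 0)
    (le_max_right _ _)
  refine ⟨M, fun v _ htube hj => hM v ?_ hj⟩
  obtain ⟨σ, hσ0, hσ1, hdist⟩ := htube
  change σ ≤ C.τc at hσ1
  change dist (read 𝒟 S n v) (C.Φ σ p) ≤ C.δsh at hdist
  have h1 := hR σ hσ0 hσ1
  have h2 : ‖read 𝒟 S n v‖ ≤ ‖C.Φ σ p‖ + dist (read 𝒟 S n v) (C.Φ σ p) := by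
    rw [dist_eq_norm]; exact norm_le_insert' _ _
  exact le_trans (by linarith) (le_max_left _ _)

/-- **Passive open circuits have bounded orbits**: if the two-block energy `W = a² + η b²` never
exceeds `W(p) + ε` along the orbit of `p ∈ AinO`, then `‖Φ σ p‖ ≤ √(W(p) + ε) · (1 + 1/√η)` for
`0 ≤ σ ≤ τc` (sup norm on `ℝ × ℝ`). [folklore] -/
theorem orbitBound_of_passiveO {Φ : ℝ → ℝ × ℝ → ℝ × ℝ} {τc ε : ℝ} (hP : PassiveO P Φ τc ε) :
    ∀ p ∈ AinO P, ∃ R : ℝ, ∀ σ : ℝ, 0 ≤ σ → σ ≤ τc → ‖Φ σ p‖ ≤ R := by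
  intro p hp
  refine ⟨Real.sqrt (pairEnergy S.eta p + ε) * (1 + (Real.sqrt S.eta)⁻¹), fun σ hσ0 hσ1 => ?_⟩
  have hη := S.eta_pos
  have hsη := Real.sqrt_pos.2 hη
  have hW := hP p hp σ hσ0 hσ1
  obtain ⟨q, hq⟩ : ∃ q, q = Φ σ p := ⟨_, rfl⟩
  rw [← hq] at hW ⊢
  unfold pairEnergy at hW
  have hB := Real.sqrt_nonneg (pairEnergy S.eta p + ε)
  have h1 : |q.1| ≤ Real.sqrt (pairEnergy S.eta p + ε) := by
    rw [← Real.sqrt_sq_eq_abs]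
    exact Real.sqrt_le_sqrt (by unfold pairEnergy; nlinarith [sq_nonneg q.2])
  have h2 : Real.sqrt S.eta * |q.2| ≤ Real.sqrt (pairEnergy S.eta p + ε) := by
    rw [← Real.sqrt_sq_eq_abs, ← Real.sqrt_mul hη.le]
    exact Real.sqrt_le_sqrt (by unfold pairEnergy; nlinarith [sq_nonneg q.1])
  have h2' : |q.2| ≤ Real.sqrt (pairEnergy S.eta p + ε) * (Real.sqrt S.eta)⁻¹ := by
    rw [← div_eq_mul_inv, le_div_iff₀ hsη, mul_comm]; exact h2
  have hinv : 0 ≤ (Real.sqrt S.eta)⁻¹ := inv_nonneg.2 hsη.le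
  rw [Prod.norm_def, Real.norm_eq_abs, Real.norm_eq_abs]
  exact max_le (by nlinarith) (by nlinarith)

/-- **Liveness of the open design from the residue alone, for a passive circuit** (`s ≥ 10`,
`μ > 0`): the pump cascade assembled from an `ε`-passive open circuit+clock and its idea-bound
half is LIVE — a theorem of the mild `H¹⁰` theory (`h10MildTheory_holds`). [folklore] -/
theorem live_of_openIdeaBound (C : OpenCircuitClock P) (H : OpenIdeaBound 𝒟 P C) (hs : 10 ≤ P.s)
    (hμ : 0 < P.μ) {ε : ℝ} (hP : PassiveO P C.Φ C.τc ε) :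
    (C.toShadowedCircuit H).toPumpCascade.Live :=
  live_of_h10ControlAt _ h10MildTheory_holds (C.h10ControlAt H hs hμ (orbitBound_of_passiveO hP))

/-- **THE CASCADE THEOREM for a passive open design** (`α > 0`, `η > 1/4`, `s ≥ 10`, `μ > 0`):
given the residue `OpenIdeaBound`, along the seed's maximal `H¹⁰_df`-mild Navier–Stokes trajectory
the spec's energy `E_n` is present at frequency `≥ λ_n = 2ⁿ λ₀` at a clocked instant
`t_n ≤ ∑_{k<n} Tmax k < S_m ≤ T_*` for EVERY generation `n`, and the `H¹⁰` norm is unbounded on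
`[0, S_m)`. HONEST FRAMING: an implication from a `Prop` presumed false; NOT a claim about NS. -/
theorem energy_reaches_all_scales_of_openIdeaBound (C : OpenCircuitClock P)
    (H : OpenIdeaBound 𝒟 P C) (hs : 10 ≤ P.s) (hμ : 0 < P.μ) {ε : ℝ} (hP : PassiveO P C.Φ C.τc ε)
    (hα : 0 < S.alpha) (hη : 1 / 4 < S.eta) :
    ∃ Sm : ℝ, 0 < Sm ∧ Sm ≤ S.Tstar ∧ ∃ U : ℝ → L2C,
      IsMildSolutionFor eulerForm (schwartzL2 (seed 𝒟 P)) (Ico 0 Sm) U ∧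
      (∀ C : ℝ, ∃ s ∈ Ico 0 Sm, ENNReal.ofReal C < eFourierSobolevNorm 10 (U s)) ∧
      ∃ t : ℕ → ℝ, t 0 = 0 ∧ Monotone t ∧
        ∀ n, t n < Sm ∧ t n ≤ ∑ k ∈ Finset.range n, S.Tmax k ∧
          ENNReal.ofReal (S.Emin n) ≤ highFreqEnergy (S.lam n) (U (t n)) :=
  energy_reaches_all_scales_of_h10ControlAt (C.toShadowedCircuit H) hα hη
    (C.h10ControlAt H hs hμ (orbitBound_of_passiveO hP))

end Control

/-! ## §3. The explicit conservative open design on `Params.reg` is live -/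

section Reg

variable {𝒟 : CascadeWaveletData 1 1} {S : CascadeSpecs}

/-- **The conservative quarter-turn open design is LIVE given its residue** (`Params.reg`: `s = 10`,
`μ = 1`; `η ∈ [1/2, 9/10]`): the gen-31 liveness theorem transfers to the open-window correction.
[folklore] -/
theorem live_of_openRegIdeaBound (hS : S.lam0 = 1) (hη : 1 / 2 ≤ S.eta) (hη2 : S.eta ≤ 9 / 10)
    (H : OpenIdeaBound 𝒟 (Params.reg S hS hη) (openRegCircuitClock S hS hη hη2)) :
    ((openRegCircuitClock S hS hη hη2).toShadowedCircuit H).toPumpCascade.Live :=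
  live_of_openIdeaBound _ H le_rfl one_pos (regGate_passiveO _ _)

/-- **THE CASCADE THEOREM for the conservative open design on `Params.reg`** (`α > 0`,
`η ∈ [1/2, 9/10]`), given the residue `OpenIdeaBound`: energy `E_n` at frequency `≥ 2ⁿ λ₀` at
clocked instants `t_n ≤ ∑_{k<n} Tmax k < S_m ≤ T_*` for every `n` along the seed's maximal mild
trajectory, whose `H¹⁰` norm is unbounded on `[0, S_m)`. HONEST FRAMING: an implication from a
`Prop` this lane presumes FALSE; NOT a claim that NS blows up. -/
theorem energy_reaches_all_scales_of_openRegIdeaBound (hS : S.lam0 = 1) (hη : 1 / 2 ≤ S.eta)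
    (hη2 : S.eta ≤ 9 / 10) (hα : 0 < S.alpha)
    (H : OpenIdeaBound 𝒟 (Params.reg S hS hη) (openRegCircuitClock S hS hη hη2)) :
    ∃ Sm : ℝ, 0 < Sm ∧ Sm ≤ S.Tstar ∧ ∃ U : ℝ → L2C,
      IsMildSolutionFor eulerForm (schwartzL2 (seed 𝒟 (Params.reg S hS hη))) (Ico 0 Sm) U ∧
      (∀ C : ℝ, ∃ s ∈ Ico 0 Sm, ENNReal.ofReal C < eFourierSobolevNorm 10 (U s)) ∧
      ∃ t : ℕ → ℝ, t 0 = 0 ∧ Monotone t ∧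
        ∀ n, t n < Sm ∧ t n ≤ ∑ k ∈ Finset.range n, S.Tmax k ∧
          ENNReal.ofReal (S.Emin n) ≤ highFreqEnergy (S.lam n) (U (t n)) :=
  energy_reaches_all_scales_of_openIdeaBound _ H le_rfl one_pos (regGate_passiveO _ _) hα
    (by linarith)

end Reg

end BlockDesign

end Summit.NavierStokesRegularity.FluidComputer

end
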